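import Mathlib
import HarnessLib

/-!
# Rohlfs (1996), Prop. 2.10 / Cor. 2.12–2.13: the cohomology of each level `S̄(U) = S̄/U` of the tower
# of arithmetic quotients is the `U`-invariants of the smooth `G(𝔸_f)`-module `H*(S̄, A)` —
# dictionary level, with the level-change corollaries proved

Source: J. Rohlfs, *Projective limits of locally symmetric spaces and cohomology*, J. reine angew.
Math. **479** (1996) 149–182 [Rohlfs1996], read on the GDZ page images (Crelle PPN243919689_0479,
canvas = printed page + 4).  Verbatim:

* Introduction, p. 149: "If `Γ₁` is a normal congruence subgroup of `Γ` then `Γ/Γ₁` acts on `H*(Γ₁, V)`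
  and `H*(Γ, V) ≅ H*(Γ₁, V)^{Γ/Γ₁}` canonically."  p. 150: "`X = X_∞ × G(𝔸_f)` … `S = G(ℚ)\X` and
  `S(K_f) = G(ℚ)\X/K_f`.  Then `S(K_f) = Σ_i X_∞/Γ_i` for finitely many congruence subgroups `Γ_i`. …
  – `lim_→ H*(S(K_f), B^{K_f}) ≅ H*(S, B)` and `H*(S, B)` is a `G(𝔸_f)`-module. …
  – `H*(S(K_f), B^{K_f}) ≅ H*(S, B)^{K_f}`."
* §1.2 p. 152: "Let `ℓ` be the semi-simple `ℚ`-rank of `G`. Then `∂X̄⁰_∞ = ∅` if and only if `ℓ = 0`."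
  §1.3 p. 153: "`S(K_f) = S/K_f`, `S̄(K_f) = S̄/K_f`"; Prop. 1.4 p. 153: "`S̄(K_f)` is compact." with, in
  its proof, "`S̄(K_f) = ⋃_{g_f} G(ℚ)\(X̄_∞ × (G(ℚ)g_f K_f))/K_f` as a disjoint union, where `g_f` runs in
  `G(ℚ)\G(𝔸_f)/K_f`.  Put `Γ_{g_f} = G(ℚ) ∩ g_f K_f g_f⁻¹`. Then `Γ_{g_f}` is an arithmetic group and there
  is a bijection (*) `Γ_{g_f}\X̄_∞ ⥲ G(ℚ)\(X̄_∞ × (G(ℚ)g_f K_f))/K_f`".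
* §2.1 (i), (iii) p. 155: "For `M ∈ Mod_H` we put `M^H = {m ∈ M | hm = m for all h ∈ H}`", "we assume
  throughout that `H` is an open subgroup of `π₀(G) × G(𝔸_f)`. The most important examples for us are
  of course `H = G(𝔸_f)` or `H = K_f`"; §2.2 (i) p. 155: "`M` is smooth … if `⋃_U M^U = M`, where `U`
  runs in the set of all open and compact subgroups of `H`"; §2.2 (ii) p. 156: "`M^∞ = M^∞_H = ⋃_U M^U`
  … `M^∞_H` is the biggest smooth `H`-submodule of `M`."  §2.9 p. 158: "The projection
  `f_U : Y → U\Y` induces a map `H*(U\Y, A^U) → H*(Y, f⁻¹A^U)`. We compose this map with the one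
  induced by the natural map `f_U⁻¹A^U → A` and get a map `f_U^* : H*(U\Y, A^U) → H*(Y, A)`."  p. 159:
  "We consider all such groups `U`. Then the `f_U^*` form a system of compatible maps and we get a
  natural map `f^* : lim_→ H*(U\Y, A^U) → H*(Y, A)`. We observe that `f^*` is `H`-equivariant."
* **Prop. 2.10** p. 159: "Let `A ∈ Sh^∞_H(Y)` be a smooth sheaf of `R[H]`-modules where `ℚ ⊂ R`.
  Assume that `Y` is compact. Then: (i) `f^* : lim_→ H*(U\Y, A^U) → H*(Y, A)` is an isomorphism of
  smooth `R[H]`-modules. (ii) `f_U^* : H*(U\Y, A^U) ⥲ H*(Y, A)^U` is an isomorphism."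
* **Cor. 2.12** pp. 159–160: "Let `A ∈ Sh^∞_H(S̄)` and assume that `ℚ ⊂ R`. Then we have functorial
  isomorphisms of `H`-modules `lim_→ H*(S̄(U), A^U) ⥲ H*(S̄, A)`, `lim_→ H*(∂S̄(U), A^U) ⥲ H*(∂S̄, A)`,
  `lim_→ H_c*(S(U), A^U) ⥲ H_c*(S, A)`, where `U` runs in the set of open and compact subgroups of
  `H`. … Moreover `H_c*(S(U), A^U) ⥲ H_c(S, A)^U`."
* **Cor. 2.13** p. 160: "Let `A ∈ Sh_{G(𝔸_f)}(S̄)` be a locally constant sheaf of finite dimensional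
  `ℂ`-vectorspaces. Then `H*(S̄, A)`, `H*(∂S̄, A)` and `H_c*(S, A)` are admissible `G(𝔸_f)`-modules."
  (proof: "We have to show that `H*(S̄, A)^{K_f}` … are finite dimensional for all open and compact
  subgroups `K_f` of `G(𝔸_f)`. … By 2.10 and 2.12 we have `H*(S(K_f), A^{K_f}) ≅ H*(S̄, A)^{K_f}` …")

What is TYPED (dictionary `CohLevelTower H R`: a group `H` [`= G(𝔸_f)`], a family of subgroups `U`
[the open compact ones], the modules `Coh U` [`= H*(S̄(U), A^U)`, one degree or all], the module
`Lim` [`= H*(S̄, A)`] with its `H`-action, the maps `f_U^*` and the pull-backs `res` along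
`S̄(U') → S̄(U)` for `U' ≤ U`, with the printed compatibility `f_{U'}^* ∘ res = f_U^*`):
`Prop_2_10` = (ii) at every level + the surjectivity half of (i) (`H*(S̄, A) = ⋃_U im f_U^*`, i.e.
`H*(S̄, A)` is smooth, 2.2 (ii)); `Cor_2_13` = finite generation of every `H*(S̄, A)^U`.  NOTHING IS
ASSERTED: consumers take `(h : T.Prop_2_10)` as a hypothesis.  PROVED over the dictionary: the
pull-backs are injective (`res_injective`), a class at level `U'` comes from level `U ≥ U'` iff its
image is `U`-invariant (`range_res_eq` — the tower form of "`H*(Γ, V) ≅ H*(Γ₁, V)^{Γ/Γ₁}`", p. 149),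
each `H*(S̄(U), A^U)` is `≃` the invariants (`cohEquivInvariants`) and hence finitely generated under
Cor. 2.13 (`finite_coh`), and `h ∈ H` carries `U`-invariants to `hUh⁻¹`-invariants (`act_mem_invariants_conj`,
the group-theoretic half of the Hecke operators of p. 149).

Scope (as printed): `G` a connected reductive `ℚ`-group, `S̄` the Borel–Serre compactification of
`S = G(ℚ)\(X_∞ × G(𝔸_f))`; for `ℚ`-anisotropic `G` (semisimple `ℚ`-rank `ℓ = 0`, e.g. the unitary group
of an anisotropic hermitian space over a CM field, the HodgeConjecture/PerL cell's `G_U`) `∂X̄_∞ = ∅`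
(1.2), so `S̄ = S` and `S(K_f)` is a finite disjoint union of compact quotients `Γ_{g_f}\X_∞` (1.4 (*)).
NOT here: sheaves, Borel–Serre, the construction of `f_U^*`, §§3–6 (group-cohomological description,
Steinberg module, ghost classes).

## References
* J. Rohlfs, J. reine angew. Math. 479 (1996) 149–182: Introduction pp. 149–151, §1.1–1.6
  pp. 152–153, §2.2, 2.9, Prop. 2.10, Cor. 2.11–2.13, Prop. 2.14, pp. 155–160. [Rohlfs1996]
-/

namespace Literature.NumberTheory.Rohlfs1996

universe u v w

/-- Dictionary for Rohlfs 1996 §2: the tower `U ↦ H*(S̄(U), A^U)` under a group `H` (`= G(𝔸_f)`),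
its limit `H*(S̄, A)` with the `H`-action, the maps `f_U^*` (2.9) and the pull-backs along
`S̄(U') → S̄(U)`, `U' ≤ U`, with "the `f_U^*` form a system of compatible maps" (p. 159).
[cite: Rohlfs1996, §2.9 p. 158 and p. 159] -/
structure CohLevelTower (H : Type u) [Group H] (R : Type v) [CommRing R] where
  /-- index type of the levels (the open compact subgroups `U ⊂ H` considered) -/
  Level : Type w
  /-- the subgroup `U` of a level -/
  grp : Level → Subgroup H
  /-- `H*(S̄(U), A^U)` -/
  Coh : Level → Type w
  /-- additive structure of `H*(S̄(U), A^U)` -/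
  [instAddCommGroup : ∀ U, AddCommGroup (Coh U)]
  /-- `R`-module structure of `H*(S̄(U), A^U)` -/
  [instModule : ∀ U, Module R (Coh U)]
  /-- `H*(S̄, A)` -/
  Lim : Type w
  /-- additive structure of `H*(S̄, A)` -/
  [instAddCommGroupLim : AddCommGroup Lim]
  /-- `R`-module structure of `H*(S̄, A)` -/
  [instModuleLim : Module R Lim]
  /-- the `H`-module structure of `H*(S̄, A)` ("`H*(S, B)` is a `G(𝔸_f)`-module", p. 150) -/
  act : Representation R H Lim
  /-- `f_U^* : H*(S̄(U), A^U) → H*(S̄, A)` (2.9) -/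
  f : ∀ U, Coh U →ₗ[R] Lim
  /-- pull-back along the covering `S̄(U') → S̄(U)` for `U' ≤ U` -/
  res : ∀ U U', grp U' ≤ grp U → (Coh U →ₗ[R] Coh U')
  /-- compatibility: `f_{U'}^* ∘ res_{U,U'} = f_U^*` (p. 159, "a system of compatible maps") -/
  f_comp_res : ∀ (U U') (h : grp U' ≤ grp U), (f U') ∘ₗ (res U U' h) = f U

attribute [instance] CohLevelTower.instAddCommGroup CohLevelTower.instModule
  CohLevelTower.instAddCommGroupLim CohLevelTower.instModuleLim

namespace CohLevelTower

variable {H : Type u} [Group H] {R : Type v} [CommRing R] (T : CohLevelTower H R)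

/-- `H*(S̄, A)^U`: the `U`-invariants of the limit module.
[cite: Rohlfs1996, Prop 2.10 (ii), p. 159] -/
def invariants (U : T.Level) : Submodule R T.Lim where
  carrier := {x | ∀ h ∈ T.grp U, T.act h x = x}
  zero_mem' h _ := by simp only [map_zero]
  add_mem' {x} {y} hx hy h hh := by simp only [map_add, hx h hh, hy h hh]
  smul_mem' r {x} hx h hh := by simp only [map_smul, hx h hh]

/-- Membership in `H*(S̄, A)^U`. [cite: Rohlfs1996, Prop 2.10 (ii), p. 159] -/
theorem mem_invariants_iff (U : T.Level) (x : T.Lim) :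
    x ∈ T.invariants U ↔ ∀ h ∈ T.grp U, T.act h x = x := Iff.rfl

/-- **Rohlfs 1996, Prop. 2.10** (with Cor. 2.12 for `Y = S̄`), AS A HYPOTHESIS on the dictionary:
(ii) every `f_U^* : H*(S̄(U), A^U) → H*(S̄, A)^U` is an isomorphism — typed as: `f_U^*` is injective
with range the `U`-invariants; (i) `f^* : lim_→ H*(S̄(U), A^U) ⥲ H*(S̄, A)` — typed as its surjectivity
half "every class of `H*(S̄, A)` comes from some level" (`H*(S̄, A)` is smooth, 2.2 (ii); injectivity
of `f^*` on the limit is (ii)).  Printed hypotheses: `A` a smooth sheaf of `R[H]`-modules, `ℚ ⊂ R`,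
`S̄(U)` compact (1.4). [cite: Rohlfs1996, Prop 2.10 p. 159; Cor 2.12 pp. 159–160] -/
def Prop_2_10 (T : CohLevelTower H R) : Prop :=
  (∀ U, Function.Injective (T.f U) ∧ LinearMap.range (T.f U) = T.invariants U) ∧
    ∀ x : T.Lim, ∃ U, x ∈ LinearMap.range (T.f U)

/-- **Rohlfs 1996, Cor. 2.13** (admissibility), AS A HYPOTHESIS: every `H*(S̄, A)^{K_f}` is finite
dimensional — typed as finite generation over `R` (printed: `A` locally constant of finite-dimensional
`ℂ`-vector spaces, `R = ℂ`). [cite: Rohlfs1996, Cor 2.13, p. 160] -/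
def Cor_2_13 (T : CohLevelTower H R) : Prop := ∀ U, Module.Finite R (T.invariants U)

/-! ## Proved over the dictionary: level change -/

/-- Classes of a coarse level are classes of every finer level: for `U' ≤ U`,
`im f_U^* ≤ im f_{U'}^*` in `H*(S̄, A)` (from the compatibility alone, no hypothesis).
[cite: Rohlfs1996, §2.9, p. 159] -/
theorem range_f_mono (U U' : T.Level) (hle : T.grp U' ≤ T.grp U) :
    LinearMap.range (T.f U) ≤ LinearMap.range (T.f U') := by
  rintro _ ⟨x, rfl⟩
  exact ⟨T.res U U' hle x, by rw [← LinearMap.comp_apply, T.f_comp_res]⟩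

/-- Invariants shrink as the level group grows: `U' ≤ U ⇒ H*(S̄, A)^U ≤ H*(S̄, A)^{U'}`.
[cite: Rohlfs1996, §2.2, p. 155] -/
theorem invariants_anti (U U' : T.Level) (hle : T.grp U' ≤ T.grp U) :
    T.invariants U ≤ T.invariants U' :=
  fun _ hx h hh => hx h (hle hh)

/-- The image of `f_U^*` consists of `U`-invariant classes (from Prop. 2.10 (ii)).
[cite: Rohlfs1996, Prop 2.10 (ii), p. 159] -/
theorem f_mem_invariants (h : T.Prop_2_10) (U : T.Level) (x : T.Coh U) :
    T.f U x ∈ T.invariants U := by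
  rw [← (h.1 U).2]
  exact LinearMap.mem_range_self _ _

/-- **Pull-backs in the tower are injective**: for `U' ≤ U` the map
`H*(S̄(U), A^U) → H*(S̄(U'), A^{U'})` is injective (since `f_{U'}^* ∘ res = f_U^*` and `f_U^*` is
injective). [cite: Rohlfs1996, Prop 2.10, p. 159] -/
theorem res_injective (h : T.Prop_2_10) (U U' : T.Level) (hle : T.grp U' ≤ T.grp U) :
    Function.Injective (T.res U U' hle) := by
  intro x y hxy
  apply (h.1 U).1
  rw [← T.f_comp_res U U' hle, LinearMap.comp_apply, LinearMap.comp_apply, hxy]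

/-- **Level change = taking invariants** (the tower form of "`H*(Γ, V) ≅ H*(Γ₁, V)^{Γ/Γ₁}`
canonically", Introduction p. 149): for `U' ≤ U`, a class at level `U'` is pulled back from level `U`
iff its image in `H*(S̄, A)` is `U`-invariant. [cite: Rohlfs1996, Introduction p. 149; Prop 2.10 p. 159] -/
theorem range_res_eq (h : T.Prop_2_10) (U U' : T.Level) (hle : T.grp U' ≤ T.grp U) :
    LinearMap.range (T.res U U' hle) = (T.invariants U).comap (T.f U') := by
  apply le_antisymm
  · rintro _ ⟨x, rfl⟩
    rw [Submodule.mem_comap, ← LinearMap.comp_apply, T.f_comp_res]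
    exact T.f_mem_invariants h U x
  · intro y hy
    rw [Submodule.mem_comap, ← (h.1 U).2] at hy
    obtain ⟨x, hx⟩ := hy
    refine ⟨x, (h.1 U').1 ?_⟩
    rw [← LinearMap.comp_apply, T.f_comp_res, hx]

/-- `H*(S̄(U), A^U) ≃ H*(S̄, A)^U` as `R`-modules, from Prop. 2.10 (ii).
[cite: Rohlfs1996, Prop 2.10 (ii), p. 159] -/
noncomputable def cohEquivInvariants (h : T.Prop_2_10) (U : T.Level) :
    T.Coh U ≃ₗ[R] T.invariants U :=
  (LinearEquiv.ofInjective (T.f U) (h.1 U).1).trans (LinearEquiv.ofEq _ _ (h.1 U).2)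

/-- Under Prop. 2.10 and Cor. 2.13 every `H*(S̄(U), A^U)` is finitely generated ("finite
dimensional", proof of 2.13: "`H*(S(K_f), A^{K_f}) ≅ H*(S̄, A)^{K_f}`").
[cite: Rohlfs1996, Cor 2.13 (proof), p. 160] -/
theorem finite_coh (h : T.Prop_2_10) (hfin : T.Cor_2_13) (U : T.Level) :
    Module.Finite R (T.Coh U) :=
  haveI := hfin U
  Module.Finite.equiv (T.cohEquivInvariants h U).symm

/-- Two classes at levels `U₁`, `U₂` with the same image in `H*(S̄, A)` agree after pull-back to any
common sublevel `U' ≤ U₁, U₂` (injectivity of `f_{U'}^*`). [cite: Rohlfs1996, Prop 2.10, p. 159] -/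
theorem res_eq_res_of_f_eq (h : T.Prop_2_10) {U₁ U₂ U' : T.Level} (h₁ : T.grp U' ≤ T.grp U₁)
    (h₂ : T.grp U' ≤ T.grp U₂) {x₁ : T.Coh U₁} {x₂ : T.Coh U₂} (hx : T.f U₁ x₁ = T.f U₂ x₂) :
    T.res U₁ U' h₁ x₁ = T.res U₂ U' h₂ x₂ := by
  apply (h.1 U').1
  rw [← LinearMap.comp_apply, ← LinearMap.comp_apply, T.f_comp_res, T.f_comp_res, hx]

/-- The group-theoretic half of the Hecke operators of p. 149 (`int g`): `h ∈ H` carries the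
`U`-invariants of `H*(S̄, A)` onto the `hUh⁻¹`-invariants. [cite: Rohlfs1996, Introduction, p. 149] -/
theorem act_mem_invariants_conj (U : T.Level) (g : H) {x : T.Lim} (hx : x ∈ T.invariants U)
    (U₁ : T.Level) (hU₁ : ∀ k, k ∈ T.grp U₁ ↔ g⁻¹ * k * g ∈ T.grp U) :
    T.act g x ∈ T.invariants U₁ := by
  rw [mem_invariants_iff] at hx ⊢
  intro k hk
  have hk' : g⁻¹ * k * g ∈ T.grp U := (hU₁ k).1 hk
  have hmul : T.act k (T.act g x) = T.act g (T.act (g⁻¹ * k * g) x) := by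
    rw [← LinearMap.comp_apply, ← LinearMap.comp_apply, ← Module.End.mul_eq_comp,
      ← Module.End.mul_eq_comp, ← map_mul, ← map_mul]
    congr 2
    group
  rw [hmul, hx _ hk']

end CohLevelTower

end Literature.NumberTheory.Rohlfs1996
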